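import Summits.AtomisticToContinuum.BoseEinsteinCondensation.Theses.BECHusimiAmplitudeGas
import Summits.AtomisticToContinuum.BoseEinsteinCondensation.Theorems.BECHusimiAmplitudeGasHusimiConcentrationBargmannII
import Summits.AtomisticToContinuum.BoseEinsteinCondensation.Theorems.BECHusimiAmplitudeGasLaplaceCapUnionModes

/-!
# Route `BECHusimiAmplitudeGas`, item `HusimiConcentration`: the exact identity and the
# reduction to slow-sector condensation

Support file for stmt-AtomisticToContinuum-11994 (`HusimiConcentration`). The route thesis rests
on the EXACT IDENTITY (Bargmann orthogonality of monomials + bosonic symmetry)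

  `E_w|F(u_c)|² = π^d N! ∑_f |A_f|²`,  `E_w[|⟨u_c,φ₀⟩|² |F(u_c)|²] = π^d N! ∑_f (1 + α₀(f)) |A_f|²`,

where `A_f = ∫_{Λ^N} ∏ⱼ conj e_{f j}(xⱼ) Ψ = ⟨e_{f 1} ⊗ ⋯ ⊗ e_{f N}, Ψ⟩` are the coefficients of
`Ψ` on the all-slow plane-wave multi-indices `f : Fin N → (modes)`, `α₀(f) = #{j | f j = i₀}` is
the number of particles of `f` in the constant mode `i₀`, and `d = (2R+1)³`. Thus
`∑_f |A_f|² = ‖P^{⊗N}Ψ‖²` and `∑_f α₀(f)|A_f|² = ⟨P^{⊗N}Ψ, n̂₀ P^{⊗N}Ψ⟩`, and the Husimi inequality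
`(1 + N/2) E_w|F|² ≤ E_w[|⟨u_c,φ₀⟩|²|F|²]` of the item says exactly that the all-slow component
`Φ = P^{⊗N}Ψ` of the nonnegative near-minimiser carries at least `N/2` particles in the constant
mode: `n₀(Φ) ≥ (N/2) ‖Φ‖²`.

Proved here (unconditionally, for every `L > 0`, `R`, and periodic trial state `Ψ`):
* `coeff_comp_perm`: the coefficients `A_f` are symmetric under relabelling (`Ψ` is bosonic);
* `husimi_weight_form_sq`, `husimi_weight_ov_sq_form_sq`: the two identities, as the `ℝ≥0∞`
  integrals appearing in the route decl;
* `husimi_conclusion_iff`: for `Ψ ≥ 0` the conclusion of `HusimiConcentration` at `Ψ` is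
  equivalent to `N ∑_f |A_f|² ≤ 2 ∑_f α₀(f) |A_f|²` (the side conditions `≠ 0`, `≠ ⊤` are automatic);
* `husimiConcentration_iff_slowSectorCondensation`: `HusimiConcentration` is equivalent to the same
  quantified statement with that conclusion — BEC (fraction `½`) of the slow-conditioned
  near-ground state, the open thermodynamic-limit content of the item;
* `tilt_conclusion_iff`: the same reduction for the inequality of `TiltStability`
  (stmt-AtomisticToContinuum-11992): `E_w[|ov|²|F|²] ≤ (X+1) E_w|F|² ⟺ ∑_f α₀(f)|A_f|² ≤ X ∑_f |A_f|²`.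
-/

noncomputable section

open MeasureTheory Set
open scoped ENNReal NNReal ComplexConjugate

namespace Summit.AtomisticToContinuum.BoseEinsteinCondensation.Theorems.BargmannIdentity

open Literature.MathematicalPhysics.QuantumManyBody.BoseGas
open Summit.AtomisticToContinuum.BoseEinsteinCondensation.Theorems.LaplaceCapUnion
open Summit.AtomisticToContinuum.BoseEinsteinCondensation.Theses.BECHusimiAmplitudeGas

/-! ### Bosonic symmetry of the coefficients -/

section Symmetry

variable {N : ℕ} {L : ℝ}

/-- Bochner integrals over the fundamental cell `Λ^N` are invariant under relabelling the
particles: `∫_{Λ^N} G(X ∘ σ) dX = ∫_{Λ^N} G(X) dX`. [folklore] -/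
theorem setIntegral_cellN_comp_perm (σ : Equiv.Perm (Fin N)) (G : Config N → ℂ) :
    ∫ X in cellN N L, G (X ∘ σ) = ∫ X in cellN N L, G X := by
  have hmp := volume_measurePreserving_piCongrLeft (fun _ : Fin N => Space) σ.symm
  have h : ∀ X : Config N,
      (MeasurableEquiv.piCongrLeft (fun _ : Fin N => Space) σ.symm) X = X ∘ σ := by
    intro X
    funext j
    simp [MeasurableEquiv.piCongrLeft, Equiv.piCongrLeft_apply_eq_cast]
  have hpre : (MeasurableEquiv.piCongrLeft (fun _ : Fin N => Space) σ.symm) ⁻¹' (cellN N L) =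
      cellN N L := by
    ext X
    simp only [Set.mem_preimage, h, cellN, Set.mem_setOf_eq, Function.comp_apply]
    exact ⟨fun hX i => by simpa using hX (σ.symm i), fun hX i => hX (σ i)⟩
  have key := hmp.setIntegral_preimage_emb (MeasurableEquiv.measurableEmbedding _) G (cellN N L)
  rw [hpre] at key
  simpa only [h] using key

/-- **The coefficients `A_f = ∫_{Λ^N} ∏ⱼ conj e_{f j}(xⱼ) Ψ` of a bosonic state are symmetric**:
`A_{f ∘ σ} = A_f` for every relabelling `σ` (change variables `X ↦ X ∘ σ⁻¹` and use
`Ψ(X ∘ σ) = Ψ(X)`). [folklore] -/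
theorem coeff_comp_perm {ι : Type*} (e : ι → Space → ℂ) (Ψ : PeriodicTrialState N L)
    (σ : Equiv.Perm (Fin N)) (f : Fin N → ι) :
    ∫ X in cellN N L, (∏ j, conj (e ((f ∘ ⇑σ) j) (X j))) * Ψ.ψ X =
      ∫ X in cellN N L, (∏ j, conj (e (f j) (X j))) * Ψ.ψ X := by
  have hpt : ∀ X : Config N, (∏ j, conj (e ((f ∘ ⇑σ) j) (X j))) * Ψ.ψ X =
      (fun Y : Config N => (∏ j, conj (e (f j) (Y j))) * Ψ.ψ Y) (X ∘ ⇑σ.symm) := by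
    intro X
    have hprod : (∏ j, conj (e ((f ∘ ⇑σ) j) (X j))) = ∏ k, conj (e (f k) ((X ∘ ⇑σ.symm) k)) := by
      rw [← Equiv.prod_comp σ (fun k => conj (e (f k) ((X ∘ ⇑σ.symm) k)))]
      simp only [Function.comp_apply, Equiv.symm_apply_apply]
    have hψ : Ψ.ψ X = Ψ.ψ (X ∘ ⇑σ.symm) := by
      conv_lhs => rw [show X = (X ∘ ⇑σ.symm) ∘ ⇑σ from by
        funext j; simp only [Function.comp_apply, Equiv.symm_apply_apply]]
      exact Ψ.symm σ (X ∘ ⇑σ.symm)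
    simp only [hprod, hψ]
  simp_rw [hpt]
  exact setIntegral_cellN_comp_perm σ.symm (fun Y : Config N => (∏ j, conj (e (f j) (Y j))) * Ψ.ψ Y)

end Symmetry

/-! ### The two identities for the route's objects -/

section Identities

variable {N : ℕ} {L : ℝ} {R : ℕ}

/-- `e^{-q} |c_{i₀}|² |P(c)|²` is integrable for an antiholomorphic form `P`. [folklore] -/
theorem integrable_gauss_mul_norm_sq_apply_mul_form_sq {ι : Type*} [Fintype ι] (i₀ : ι)
    (A : (Fin N → ι) → ℂ) :
    Integrable (fun c : ι → ℂ => Real.exp (-(∑ i, ‖c i‖ ^ 2)) *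
      (‖c i₀‖ ^ 2 * ‖∑ f : Fin N → ι, (∏ j, conj (c (f j))) * A f‖ ^ 2)) := by
  refine integrable_gauss_mul_real_of_norm_le (Continuous.aestronglyMeasurable (by
    exact ((continuous_apply i₀).norm.pow 2).mul ((continuous_form A).norm.pow 2)))
    (2 + 2 * N) ((∑ f : Fin N → ι, ‖A f‖) ^ 2) fun c => ?_
  have hq : 0 ≤ ∑ i, ‖c i‖ ^ 2 := Finset.sum_nonneg fun i _ => by positivity
  have h1 : ‖c i₀‖ ^ 2 ≤ (1 + ∑ i, ‖c i‖ ^ 2) ^ 2 := by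
    have := pow_le_pow_left₀ (norm_nonneg _) (norm_apply_le_one_add_sum c i₀) 2
    exact this
  have h2 := norm_sq_le_of_norm_le (norm_form_le A) c
  rw [Real.norm_eq_abs, abs_of_nonneg (by positivity)] at h2
  rw [Real.norm_eq_abs, abs_of_nonneg (by positivity), pow_add, mul_left_comm]
  exact mul_le_mul h1 h2 (by positivity) (by positivity)

/-- **First identity for the route's objects.** With the normalised plane waves `eᵢ` of the cube
`|n_k| ≤ R`, `u_c = ∑ cᵢeᵢ`, `F(g) = ∫_{Λ^N} ∏ⱼ conj g(xⱼ) Ψ` and `w = e^{-q}`: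
`∫⁻ w |F(u_c)|² = π^d N! ∑_f |A_f|²`, `A_f = ∫_{Λ^N} ∏ⱼ conj e_{f j}(xⱼ) Ψ`. [folklore] -/
theorem husimi_weight_form_sq (Ψ : PeriodicTrialState N L) :
    ∫⁻ c : (Fin 3 → Fin (2 * R + 1)) → ℂ, ENNReal.ofReal (Real.exp (-(∑ i, ‖c i‖ ^ 2))) *
        ((‖∫ X in cellN N L, (∏ j, conj (∑ i, c i *
          (cellWave L (fun k => ((i k : ℕ) : ℤ) - (R : ℤ)) (X j) / (Real.sqrt (L ^ 3) : ℂ)))) *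
            Ψ.ψ X‖₊ : ℝ≥0∞) ^ 2) =
      ENNReal.ofReal (Real.pi ^ Fintype.card (Fin 3 → Fin (2 * R + 1)) * N.factorial *
        ∑ f : Fin N → (Fin 3 → Fin (2 * R + 1)), ‖∫ X in cellN N L, (∏ j, conj
          (cellWave L (fun k => ((f j k : ℕ) : ℤ) - (R : ℤ)) (X j) / (Real.sqrt (L ^ 3) : ℂ))) *
            Ψ.ψ X‖ ^ 2) := by
  set e : (Fin 3 → Fin (2 * R + 1)) → Space → ℂ := fun i x =>
    cellWave L (fun k => ((i k : ℕ) : ℤ) - (R : ℤ)) x / (Real.sqrt (L ^ 3) : ℂ) with he_def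
  set A : (Fin N → (Fin 3 → Fin (2 * R + 1))) → ℂ := fun f =>
    ∫ X in cellN N L, (∏ j, conj (e (f j) (X j))) * Ψ.ψ X with hA_def
  have he_cont : ∀ i, Continuous (e i) := fun i => (continuous_cellWave L _).div_const _
  have hψc : Continuous Ψ.ψ := Ψ.contDiff.continuous
  have hFP : ∀ c : (Fin 3 → Fin (2 * R + 1)) → ℂ,
      ∫ X in cellN N L, (∏ j, conj (∑ i, c i * e i (X j))) * Ψ.ψ X =
        ∑ f : Fin N → (Fin 3 → Fin (2 * R + 1)), (∏ j, conj (c (f j))) * A f :=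
    fun c => form_expansion e he_cont hψc L c
  have hA : ∀ (σ : Equiv.Perm (Fin N)) (f : Fin N → (Fin 3 → Fin (2 * R + 1))), A (f ∘ ⇑σ) = A f :=
    fun σ f => coeff_comp_perm e Ψ σ f
  show ∫⁻ c : (Fin 3 → Fin (2 * R + 1)) → ℂ, ENNReal.ofReal (Real.exp (-(∑ i, ‖c i‖ ^ 2))) *
      ((‖∫ X in cellN N L, (∏ j, conj (∑ i, c i * e i (X j))) * Ψ.ψ X‖₊ : ℝ≥0∞) ^ 2) =
    ENNReal.ofReal (Real.pi ^ Fintype.card (Fin 3 → Fin (2 * R + 1)) * N.factorial *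
      ∑ f : Fin N → (Fin 3 → Fin (2 * R + 1)), ‖A f‖ ^ 2)
  simp_rw [hFP]
  rw [lintegral_gauss_form_sq_eq_ofReal A, integral_gauss_norm_sq_form A hA]

/-- **Second identity for the route's objects.** With `ov(g) = ∫_Λ conj g φ₀` the constant-mode
overlap: `∫⁻ w |ov(u_c)|² |F(u_c)|² = π^d N! ∑_f (α₀(f) + 1) |A_f|²`, where
`α₀(f) = #{j | f j = i₀}` counts the particles of `f` in the zero mode `i₀ = (R,R,R)`. [folklore] -/
theorem husimi_weight_ov_sq_form_sq (hL : 0 < L) (Ψ : PeriodicTrialState N L) :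
    ∫⁻ c : (Fin 3 → Fin (2 * R + 1)) → ℂ, ENNReal.ofReal (Real.exp (-(∑ i, ‖c i‖ ^ 2))) *
        ((‖∫ x in cell L, conj (∑ i, c i *
          (cellWave L (fun k => ((i k : ℕ) : ℤ) - (R : ℤ)) x / (Real.sqrt (L ^ 3) : ℂ))) *
            constantMode L x‖₊ : ℝ≥0∞) ^ 2) *
        ((‖∫ X in cellN N L, (∏ j, conj (∑ i, c i *
          (cellWave L (fun k => ((i k : ℕ) : ℤ) - (R : ℤ)) (X j) / (Real.sqrt (L ^ 3) : ℂ)))) *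
            Ψ.ψ X‖₊ : ℝ≥0∞) ^ 2) =
      ENNReal.ofReal (Real.pi ^ Fintype.card (Fin 3 → Fin (2 * R + 1)) * N.factorial *
        ∑ f : Fin N → (Fin 3 → Fin (2 * R + 1)),
          (((Finset.univ.filter fun j => f j = fun _ => (⟨R, by omega⟩ : Fin (2 * R + 1))).card : ℝ)
            + 1) *
          ‖∫ X in cellN N L, (∏ j, conj
            (cellWave L (fun k => ((f j k : ℕ) : ℤ) - (R : ℤ)) (X j) / (Real.sqrt (L ^ 3) : ℂ))) *
              Ψ.ψ X‖ ^ 2) := by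
  set i₀ : Fin 3 → Fin (2 * R + 1) := fun _ => ⟨R, by omega⟩ with hi₀_def
  set e : (Fin 3 → Fin (2 * R + 1)) → Space → ℂ := fun i x =>
    cellWave L (fun k => ((i k : ℕ) : ℤ) - (R : ℤ)) x / (Real.sqrt (L ^ 3) : ℂ) with he_def
  set A : (Fin N → (Fin 3 → Fin (2 * R + 1))) → ℂ := fun f =>
    ∫ X in cellN N L, (∏ j, conj (e (f j) (X j))) * Ψ.ψ X with hA_def
  have he_cont : ∀ i, Continuous (e i) := fun i => (continuous_cellWave L _).div_const _
  have hψc : Continuous Ψ.ψ := Ψ.contDiff.continuous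
  have hFP : ∀ c : (Fin 3 → Fin (2 * R + 1)) → ℂ,
      ∫ X in cellN N L, (∏ j, conj (∑ i, c i * e i (X j))) * Ψ.ψ X =
        ∑ f : Fin N → (Fin 3 → Fin (2 * R + 1)), (∏ j, conj (c (f j))) * A f :=
    fun c => form_expansion e he_cont hψc L c
  have hA : ∀ (σ : Equiv.Perm (Fin N)) (f : Fin N → (Fin 3 → Fin (2 * R + 1))), A (f ∘ ⇑σ) = A f :=
    fun σ f => coeff_comp_perm e Ψ σ f
  have hovnn : ∀ c : (Fin 3 → Fin (2 * R + 1)) → ℂ,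
      ((‖∫ x in cell L, conj (∑ i, c i * e i x) * constantMode L x‖₊ : ℝ≥0∞) ^ 2) =
        ENNReal.ofReal (‖c i₀‖ ^ 2) := by
    intro c
    rw [coe_nnnorm_pow_eq_ofReal]
    congr 1
    rw [show (∫ x in cell L, conj (∑ i, c i * e i x) * constantMode L x) = conj (c i₀) from
      ov_sum_modes hL c, Complex.norm_conj]
  show ∫⁻ c : (Fin 3 → Fin (2 * R + 1)) → ℂ, ENNReal.ofReal (Real.exp (-(∑ i, ‖c i‖ ^ 2))) *
      ((‖∫ x in cell L, conj (∑ i, c i * e i x) * constantMode L x‖₊ : ℝ≥0∞) ^ 2) *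
      ((‖∫ X in cellN N L, (∏ j, conj (∑ i, c i * e i (X j))) * Ψ.ψ X‖₊ : ℝ≥0∞) ^ 2) =
    ENNReal.ofReal (Real.pi ^ Fintype.card (Fin 3 → Fin (2 * R + 1)) * N.factorial *
      ∑ f : Fin N → (Fin 3 → Fin (2 * R + 1)),
        (((Finset.univ.filter fun j => f j = i₀).card : ℝ) + 1) * ‖A f‖ ^ 2)
  simp_rw [hFP, hovnn]
  have hpt : ∀ c : (Fin 3 → Fin (2 * R + 1)) → ℂ,
      ENNReal.ofReal (Real.exp (-(∑ i, ‖c i‖ ^ 2))) * ENNReal.ofReal (‖c i₀‖ ^ 2) *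
        ((‖∑ f : Fin N → (Fin 3 → Fin (2 * R + 1)), (∏ j, conj (c (f j))) * A f‖₊ : ℝ≥0∞) ^ 2) =
      ENNReal.ofReal (Real.exp (-(∑ i, ‖c i‖ ^ 2))) * ENNReal.ofReal (‖c i₀‖ ^ 2 *
        ‖∑ f : Fin N → (Fin 3 → Fin (2 * R + 1)), (∏ j, conj (c (f j))) * A f‖ ^ 2) := by
    intro c
    rw [coe_nnnorm_pow_eq_ofReal, mul_assoc, ← ENNReal.ofReal_mul (by positivity)]
  simp_rw [hpt]
  rw [lintegral_gauss_mul_ofReal_eq (fun c => by positivity)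
    (integrable_gauss_mul_norm_sq_apply_mul_form_sq i₀ A),
    integral_gauss_norm_sq_apply_mul_norm_sq_form i₀ A hA]

end Identities

/-! ### The reduction: Husimi concentration ⟺ slow-sector condensation -/

section Reduction

variable {N : ℕ} {L : ℝ}

/-- **Pointwise equivalence.** For `L > 0` and a nonnegative periodic trial state `Ψ`, the
conclusion of `HusimiConcentration` at `Ψ` (cutoff `R`),
`E_w|F|² ≠ 0 ∧ E_w|F|² ≠ ⊤ ∧ (1 + N/2) E_w|F|² ≤ E_w[|⟨u_c,φ₀⟩|²|F|²]`,
holds iff `N ∑_f |A_f|² ≤ 2 ∑_f α₀(f) |A_f|²` — at least half of the particles of the all-slow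
component `Φ = ∑_f A_f e_f` sit in the constant mode. The side conditions are automatic:
`E_w|F|² = π^d N! ∑_f|A_f|²` is finite, and positive because `A_{(i₀,…,i₀)} = F(φ₀) ≠ 0` for
`Ψ ≥ 0` normalised. [folklore] -/
theorem husimi_conclusion_iff (hL : 0 < L) (R : ℕ) (Ψ : PeriodicTrialState N L)
    (hΨ : ∀ X, Ψ.ψ X = ((‖Ψ.ψ X‖ : ℝ) : ℂ)) :
    let e : (Fin 3 → Fin (2 * R + 1)) → Space → ℂ := fun i x =>
      cellWave L (fun k => ((i k : ℕ) : ℤ) - (R : ℤ)) x / (Real.sqrt (L ^ 3) : ℂ)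
    let u : ((Fin 3 → Fin (2 * R + 1)) → ℂ) → Space → ℂ := fun c x => ∑ i, c i * e i x
    let F : (Space → ℂ) → ℂ := fun g => ∫ X in cellN N L, (∏ j, conj (g (X j))) * Ψ.ψ X
    let ov : (Space → ℂ) → ℂ := fun g => ∫ x in cell L, conj (g x) * constantMode L x
    let w : ((Fin 3 → Fin (2 * R + 1)) → ℂ) → ℝ≥0∞ := fun c =>
      ENNReal.ofReal (Real.exp (-(∑ i, ‖c i‖ ^ 2)))
    let A : (Fin N → (Fin 3 → Fin (2 * R + 1))) → ℂ := fun f =>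
      ∫ X in cellN N L, (∏ j, conj (e (f j) (X j))) * Ψ.ψ X
    ((∫⁻ c, w c * ((‖F (u c)‖₊ : ℝ≥0∞) ^ 2)) ≠ 0 ∧ (∫⁻ c, w c * ((‖F (u c)‖₊ : ℝ≥0∞) ^ 2)) ≠ ⊤ ∧
      ENNReal.ofReal (1 + (N : ℝ) / 2) * (∫⁻ c, w c * ((‖F (u c)‖₊ : ℝ≥0∞) ^ 2)) ≤
        ∫⁻ c, w c * ((‖ov (u c)‖₊ : ℝ≥0∞) ^ 2) * ((‖F (u c)‖₊ : ℝ≥0∞) ^ 2)) ↔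
    ((N : ℝ) * ∑ f, ‖A f‖ ^ 2 ≤
      2 * ∑ f, ((Finset.univ.filter fun j => f j = fun _ => (⟨R, by omega⟩ : Fin (2 * R + 1))).card : ℝ) *
        ‖A f‖ ^ 2) := by
  intro e u F ov w A
  set i₀ : Fin 3 → Fin (2 * R + 1) := fun _ => ⟨R, by omega⟩ with hi₀_def
  set K : ℝ := Real.pi ^ Fintype.card (Fin 3 → Fin (2 * R + 1)) * N.factorial with hK_def
  set S₀ : ℝ := ∑ f, ‖A f‖ ^ 2 with hS₀_def
  set T : ℝ := ∑ f, ((Finset.univ.filter fun j => f j = i₀).card : ℝ) * ‖A f‖ ^ 2 with hT_def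
  have hK : 0 < K := by positivity
  have hS₀nn : 0 ≤ S₀ := Finset.sum_nonneg fun f _ => sq_nonneg _
  have hTnn : 0 ≤ T := Finset.sum_nonneg fun f _ => mul_nonneg (Nat.cast_nonneg _) (sq_nonneg _)
  -- the two identities
  have hI : ∫⁻ c, w c * ((‖F (u c)‖₊ : ℝ≥0∞) ^ 2) = ENNReal.ofReal (K * S₀) :=
    husimi_weight_form_sq Ψ
  have hJ : ∫⁻ c, w c * ((‖ov (u c)‖₊ : ℝ≥0∞) ^ 2) * ((‖F (u c)‖₊ : ℝ≥0∞) ^ 2) =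
      ENNReal.ofReal (K * (T + S₀)) := by
    have h := husimi_weight_ov_sq_form_sq (R := R) hL Ψ
    rw [h]
    congr 1
    rw [hT_def, hS₀_def, ← Finset.sum_add_distrib]
    congr 1
    refine Finset.sum_congr rfl fun f _ => ?_
    ring
  -- positivity of `S₀` from the top coefficient
  have hS₀ : 0 < S₀ := by
    have hA0 : A (fun _ => i₀) ≠ 0 := by
      have h1 : A (fun _ => i₀) = F (constantMode L) := form_coeff_centre L R Ψ.ψ
      rw [h1]
      exact form_constantMode_ne_zero hL Ψ hΨ
    have hle : ‖A (fun _ => i₀)‖ ^ 2 ≤ S₀ :=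
      Finset.single_le_sum (f := fun f => ‖A f‖ ^ 2) (fun f _ => sq_nonneg _) (Finset.mem_univ _)
    exact lt_of_lt_of_le (pow_pos (norm_pos_iff.2 hA0) 2) hle
  have hN2 : (0 : ℝ) ≤ 1 + (N : ℝ) / 2 := by positivity
  rw [hI, hJ]
  constructor
  · rintro ⟨-, -, h⟩
    rw [← ENNReal.ofReal_mul hN2,
      ENNReal.ofReal_le_ofReal_iff (mul_nonneg hK.le (add_nonneg hTnn hS₀nn))] at h
    -- `(1 + N/2) K S₀ ≤ K (T + S₀)` gives `N S₀ ≤ 2 T`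
    have h2 : K * ((N : ℝ) * S₀) ≤ K * (2 * T) := by
      have e1 : K * (2 * T) - K * ((N : ℝ) * S₀) =
          2 * (K * (T + S₀) - (1 + (N : ℝ) / 2) * (K * S₀)) := by ring
      have h0 : 0 ≤ K * (T + S₀) - (1 + (N : ℝ) / 2) * (K * S₀) := sub_nonneg.2 h
      exact sub_nonneg.1 (by rw [e1]; exact mul_nonneg zero_le_two h0)
    exact le_of_mul_le_mul_left h2 hK
  · intro h
    refine ⟨(ENNReal.ofReal_pos.2 (mul_pos hK hS₀)).ne', ENNReal.ofReal_ne_top, ?_⟩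
    rw [← ENNReal.ofReal_mul hN2]
    refine ENNReal.ofReal_le_ofReal (sub_nonneg.1 ?_)
    have e2 : K * (T + S₀) - (1 + (N : ℝ) / 2) * (K * S₀) = K / 2 * (2 * T - (N : ℝ) * S₀) := by ring
    rw [e2]
    exact mul_nonneg (by positivity) (sub_nonneg.2 h)

/-- **`HusimiConcentration` ⟺ slow-sector condensation.** The route item `HusimiConcentration`
(stmt-AtomisticToContinuum-11994) is equivalent to the statement, with the same quantifier prefix
over admissible `v`, `M ≥ 1`, small `ρ`, large `N`, small `δ` and nonnegative periodic
`δ`-near-minimisers `Ψ`, that the all-slow Fourier component of `Ψ` (modes `|n_k| ≤ R`,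
`R = ⌊ML√(ρa)⌋`) carries at least `N/2` particles in the constant mode:
`N ∑_f |A_f|² ≤ 2 ∑_f α₀(f)|A_f|²`, `A_f = ⟨e_{f 1} ⊗ ⋯ ⊗ e_{f N}, Ψ⟩_{L²(Λ^N)}`,
`α₀(f) = #{j | f j = i₀}`. This is the "exact identity" reduction of the route thesis:
`E_w[|⟨u_c,φ₀⟩|²|F|²]/E_w|F|² = 1 + n₀(Φ)/‖Φ‖²`, `Φ = P^{⊗N}Ψ`. [folklore] -/
theorem husimiConcentration_iff_slowSectorCondensation :
    HusimiConcentration ↔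
    (∀ v : ℝ → ℝ≥0∞, IsRepulsiveFiniteRange v → ∀ M : ℝ, 1 ≤ M → ∃ ρ₀ : ℝ, 0 < ρ₀ ∧
      ∀ ρ : ℝ, 0 < ρ → ρ < ρ₀ → ∀ᶠ N : ℕ in Filter.atTop, ∃ δ : ℝ≥0∞, 0 < δ ∧
      ∀ Ψ : PeriodicTrialState N (sideLength ρ N),
        periodicEnergy v Ψ ≤ periodicGroundStateEnergy v N (sideLength ρ N) + δ →
        (∀ X, Ψ.ψ X = ((‖Ψ.ψ X‖ : ℝ) : ℂ)) →
        let L : ℝ := sideLength ρ N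
        let R : ℕ := ⌊M * L * Real.sqrt (ρ * (scatteringLength v).toReal)⌋₊
        let e : (Fin 3 → Fin (2 * R + 1)) → Space → ℂ := fun i x =>
          cellWave L (fun k => ((i k : ℕ) : ℤ) - (R : ℤ)) x / (Real.sqrt (L ^ 3) : ℂ)
        let A : (Fin N → (Fin 3 → Fin (2 * R + 1))) → ℂ := fun f =>
          ∫ X in cellN N L, (∏ j, conj (e (f j) (X j))) * Ψ.ψ X
        (N : ℝ) * ∑ f, ‖A f‖ ^ 2 ≤
          2 * ∑ f, ((Finset.univ.filter fun j =>
            f j = fun _ => (⟨R, by omega⟩ : Fin (2 * R + 1))).card : ℝ) * ‖A f‖ ^ 2) := by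
  unfold HusimiConcentration
  refine forall₂_congr fun v _ => forall₂_congr fun M _ => exists_congr fun ρ₀ => ?_
  refine and_congr_right fun _ => forall₃_congr fun ρ hρ _ => ?_
  refine Filter.eventually_congr ((Filter.eventually_ge_atTop 1).mono fun N hN => ?_)
  refine exists_congr fun δ => and_congr_right fun _ => forall₃_congr fun Ψ _ hΨpos => ?_
  have hNpos : 0 < N := hN
  have hL : 0 < sideLength ρ N :=
    Real.rpow_pos_of_pos (div_pos (by exact_mod_cast hNpos) hρ) _
  exact husimi_conclusion_iff hL _ Ψ hΨpos

/-- **Pointwise reduction of the tilt inequality.** For `L > 0`, a periodic trial state `Ψ`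
and any `X : ℝ≥0∞` (in `TiltStability`, stmt-AtomisticToContinuum-11992,
`X = n₀(Ψ) + C · n_fast(Ψ)`), the inequality `E_w[|⟨u_c,φ₀⟩|²|F|²] ≤ (X + 1) · E_w|F|²` holds iff
`∑_f α₀(f)|A_f|² ≤ X · ∑_f |A_f|²` (in `ℝ≥0∞`), i.e. `n₀(Φ) ≤ X ‖Φ‖²` for the all-slow component
`Φ = P^{⊗N}Ψ`: by the two identities both sides carry the common positive finite factor
`π^d N! = K`, and `E_w[|ov|²|F|²] = K(∑_f α₀|A_f|² + ∑_f|A_f|²)`. [folklore] -/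
theorem tilt_conclusion_iff (hL : 0 < L) (R : ℕ) (Ψ : PeriodicTrialState N L) (X : ℝ≥0∞) :
    let e : (Fin 3 → Fin (2 * R + 1)) → Space → ℂ := fun i x =>
      cellWave L (fun k => ((i k : ℕ) : ℤ) - (R : ℤ)) x / (Real.sqrt (L ^ 3) : ℂ)
    let u : ((Fin 3 → Fin (2 * R + 1)) → ℂ) → Space → ℂ := fun c x => ∑ i, c i * e i x
    let F : (Space → ℂ) → ℂ := fun g => ∫ X in cellN N L, (∏ j, conj (g (X j))) * Ψ.ψ X
    let ov : (Space → ℂ) → ℂ := fun g => ∫ x in cell L, conj (g x) * constantMode L x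
    let w : ((Fin 3 → Fin (2 * R + 1)) → ℂ) → ℝ≥0∞ := fun c =>
      ENNReal.ofReal (Real.exp (-(∑ i, ‖c i‖ ^ 2)))
    let A : (Fin N → (Fin 3 → Fin (2 * R + 1))) → ℂ := fun f =>
      ∫ X in cellN N L, (∏ j, conj (e (f j) (X j))) * Ψ.ψ X
    ((∫⁻ c, w c * ((‖ov (u c)‖₊ : ℝ≥0∞) ^ 2) * ((‖F (u c)‖₊ : ℝ≥0∞) ^ 2)) ≤
      (X + 1) * ∫⁻ c, w c * ((‖F (u c)‖₊ : ℝ≥0∞) ^ 2)) ↔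
    (ENNReal.ofReal (∑ f, ((Finset.univ.filter fun j =>
        f j = fun _ => (⟨R, by omega⟩ : Fin (2 * R + 1))).card : ℝ) * ‖A f‖ ^ 2) ≤
      X * ENNReal.ofReal (∑ f, ‖A f‖ ^ 2)) := by
  intro e u F ov w A
  set i₀ : Fin 3 → Fin (2 * R + 1) := fun _ => ⟨R, by omega⟩ with hi₀_def
  set K : ℝ := Real.pi ^ Fintype.card (Fin 3 → Fin (2 * R + 1)) * N.factorial with hK_def
  set S₀ : ℝ := ∑ f, ‖A f‖ ^ 2 with hS₀_def
  set T : ℝ := ∑ f, ((Finset.univ.filter fun j => f j = i₀).card : ℝ) * ‖A f‖ ^ 2 with hT_def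
  have hK : 0 < K := by positivity
  have hS₀nn : 0 ≤ S₀ := Finset.sum_nonneg fun f _ => sq_nonneg _
  have hTnn : 0 ≤ T := Finset.sum_nonneg fun f _ => mul_nonneg (Nat.cast_nonneg _) (sq_nonneg _)
  have hI : ∫⁻ c, w c * ((‖F (u c)‖₊ : ℝ≥0∞) ^ 2) = ENNReal.ofReal (K * S₀) :=
    husimi_weight_form_sq Ψ
  have hJ : ∫⁻ c, w c * ((‖ov (u c)‖₊ : ℝ≥0∞) ^ 2) * ((‖F (u c)‖₊ : ℝ≥0∞) ^ 2) =
      ENNReal.ofReal (K * T) + ENNReal.ofReal (K * S₀) := by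
    have h := husimi_weight_ov_sq_form_sq (R := R) hL Ψ
    rw [h, ← ENNReal.ofReal_add (mul_nonneg hK.le hTnn) (mul_nonneg hK.le hS₀nn)]
    congr 1
    rw [hT_def, hS₀_def, ← mul_add, ← Finset.sum_add_distrib]
    congr 1
    refine Finset.sum_congr rfl fun f _ => ?_
    ring
  rw [hI, hJ, add_mul, one_mul, ENNReal.add_le_add_iff_right ENNReal.ofReal_ne_top,
    ENNReal.ofReal_mul hK.le, ENNReal.ofReal_mul hK.le, ← mul_assoc, mul_comm X, mul_assoc]
  exact ENNReal.mul_le_mul_iff_right ((ENNReal.ofReal_pos.2 hK).ne') ENNReal.ofReal_ne_top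

end Reduction

end Summit.AtomisticToContinuum.BoseEinsteinCondensation.Theorems.BargmannIdentity
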